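import Mathlib
import Summits.ValiantsHypothesis.ValiantsHypothesis.Theorems.NewtonUnitEquationsDissociatedUniformGenericDefs

/-!
# Generic stratum of crux `DissociatedUniform` — counting lemma

Crux stmt-ValiantsHypothesis-5905 (`NewtonUnitEquations.DissociatedUniform`), line `greedy-basis-shadow`, by-product
"generic stratum" (lead c5).  This file is pure counting: the number of tuples `g : Fin d → ℕ` with
`∏ s, (1 + g s) ≤ k` is at most `2 ^ d * k ^ 2` (`card_Tset_le`).  Proof: peel the first coordinate,
`T(d+1, k) ≤ Σ_{g < k} T(d, k / (1+g))`, and `Σ_{i=1}^{k} ⌊k/i⌋² ≤ 2k²` (from `Σ 1/i² ≤ 2`). [folklore]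
-/

open scoped BigOperators

-- Sub = Summit single-conjunct layout: the duplicated namespace component is mandated by the tree.
set_option linter.dupNamespace false

namespace Summit.ValiantsHypothesis.ValiantsHypothesis.Theorems.NewtonUnitEquationsDissociatedUniform

namespace Generic

/-- Membership in `Tset` is exactly the product condition. -/
theorem mem_Tset {d k : ℕ} (g : Fin d → ℕ) : g ∈ Tset d k ↔ ∏ s, (1 + g s) ≤ k := by
  unfold Tset
  refine ⟨fun h => (Finset.mem_filter.mp h).2, fun h => Finset.mem_filter.mpr ⟨?_, h⟩⟩
  refine Fintype.mem_piFinset.mpr fun s => Finset.mem_range.mpr ?_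
  have h1 : 1 + g s ≤ ∏ s', (1 + g s') :=
    Finset.single_le_prod' (f := fun s' => 1 + g s') (fun s' _ => Nat.le_add_right 1 (g s')) (Finset.mem_univ s)
  omega

/-- `T(0, k) ≤ 1`. -/
theorem card_Tset_zero_le (k : ℕ) : (Tset 0 k).card ≤ 1 := by
  unfold Tset
  exact (Finset.card_le_card (Finset.filter_subset _ _)).trans (by simp)

/-- `T(0, 0) = 0` (the empty product is `1 > 0`). -/
theorem Tset_zero_zero : Tset 0 0 = ∅ := by
  ext g
  simp [mem_Tset]

/-- `T(d, k) ≤ k ^ 2` for `d = 0`. -/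
theorem card_Tset_zero_le_sq (k : ℕ) : (Tset 0 k).card ≤ k ^ 2 := by
  rcases Nat.eq_zero_or_pos k with rfl | hk
  · simp [Tset_zero_zero]
  · exact (card_Tset_zero_le k).trans (Nat.one_le_pow _ _ hk)

/-- Peeling the first coordinate: `Tset (d+1) k` lies in the union over the first entry `g₀ < k` of the images of
`Tset d (k / (1 + g₀))` under `Fin.cons g₀`. -/
theorem Tset_succ_subset (d k : ℕ) :
    Tset (d + 1) k ⊆ (Finset.range k).biUnion fun g₀ => (Tset d (k / (1 + g₀))).image (fun t : Fin d → ℕ => (Fin.cons g₀ t : Fin (d + 1) → ℕ)) := by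
  intro g hg
  have hprod := (mem_Tset g).mp hg
  rw [Fin.prod_univ_succ] at hprod
  have hpos : 0 < 1 + g 0 := by omega
  have hg0 : g 0 < k := by
    have h1 : 1 ≤ ∏ s : Fin d, (1 + g s.succ) := Finset.one_le_prod' fun s _ => Nat.le_add_right 1 _
    nlinarith
  refine Finset.mem_biUnion.mpr ⟨g 0, Finset.mem_range.mpr hg0, Finset.mem_image.mpr ⟨Fin.tail g, ?_, Fin.cons_self_tail g⟩⟩
  refine (mem_Tset _).mpr ((Nat.le_div_iff_mul_le hpos).mpr ?_)
  have htail : (∏ s : Fin d, (1 + Fin.tail g s)) = ∏ s : Fin d, (1 + g s.succ) :=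
    Finset.prod_congr rfl fun s _ => rfl
  calc (∏ s : Fin d, (1 + Fin.tail g s)) * (1 + g 0) = (1 + g 0) * ∏ s : Fin d, (1 + g s.succ) := by
        rw [htail, Nat.mul_comm]
    _ ≤ k := hprod

/-- The recursion inequality `T(d+1, k) ≤ Σ_{g₀ < k} T(d, k / (1 + g₀))`. -/
theorem card_Tset_succ_le (d k : ℕ) :
    (Tset (d + 1) k).card ≤ ∑ g₀ ∈ Finset.range k, (Tset d (k / (1 + g₀))).card := by
  have h1 : (Tset (d + 1) k).card ≤
      ((Finset.range k).biUnion fun g₀ => (Tset d (k / (1 + g₀))).image (fun t : Fin d → ℕ => (Fin.cons g₀ t : Fin (d + 1) → ℕ))).card :=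
    Finset.card_le_card (Tset_succ_subset d k)
  have h2 : ((Finset.range k).biUnion fun g₀ => (Tset d (k / (1 + g₀))).image (fun t : Fin d → ℕ => (Fin.cons g₀ t : Fin (d + 1) → ℕ))).card ≤
      ∑ g₀ ∈ Finset.range k, ((Tset d (k / (1 + g₀))).image (fun t : Fin d → ℕ => (Fin.cons g₀ t : Fin (d + 1) → ℕ))).card :=
    Finset.card_biUnion_le
  have h3 : ∑ g₀ ∈ Finset.range k, ((Tset d (k / (1 + g₀))).image (fun t : Fin d → ℕ => (Fin.cons g₀ t : Fin (d + 1) → ℕ))).card ≤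
      ∑ g₀ ∈ Finset.range k, (Tset d (k / (1 + g₀))).card :=
    Finset.sum_le_sum fun g₀ _ => Finset.card_image_le
  exact h1.trans (h2.trans h3)

/-- `Σ_{g < k} ⌊k / (1+g)⌋² ≤ 2 k²` (from `Σ_{i ≥ 1} 1/i² ≤ 2`). -/
theorem sum_div_sq_le (k : ℕ) : ∑ g₀ ∈ Finset.range k, (k / (1 + g₀)) ^ 2 ≤ 2 * k ^ 2 := by
  have hreal : (∑ g₀ ∈ Finset.range k, ((k / (1 + g₀) : ℕ) : ℝ) ^ 2) ≤ 2 * (k : ℝ) ^ 2 := by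
    calc (∑ g₀ ∈ Finset.range k, ((k / (1 + g₀) : ℕ) : ℝ) ^ 2)
        ≤ ∑ g₀ ∈ Finset.range k, (k : ℝ) ^ 2 * (((1 + g₀ : ℕ) : ℝ) ^ 2)⁻¹ := by
          refine Finset.sum_le_sum fun g₀ _ => ?_
          have hpos : (0 : ℝ) < ((1 + g₀ : ℕ) : ℝ) := by positivity
          have hdiv : ((k / (1 + g₀) : ℕ) : ℝ) ≤ (k : ℝ) / ((1 + g₀ : ℕ) : ℝ) := Nat.cast_div_le
          have hnn : (0 : ℝ) ≤ ((k / (1 + g₀) : ℕ) : ℝ) := Nat.cast_nonneg _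
          calc ((k / (1 + g₀) : ℕ) : ℝ) ^ 2 ≤ ((k : ℝ) / ((1 + g₀ : ℕ) : ℝ)) ^ 2 := pow_le_pow_left₀ hnn hdiv 2
            _ = (k : ℝ) ^ 2 * (((1 + g₀ : ℕ) : ℝ) ^ 2)⁻¹ := by rw [div_pow, div_eq_mul_inv]
      _ = (k : ℝ) ^ 2 * ∑ g₀ ∈ Finset.range k, (((1 + g₀ : ℕ) : ℝ) ^ 2)⁻¹ := by rw [Finset.mul_sum]
      _ = (k : ℝ) ^ 2 * ∑ i ∈ Finset.Ioo 0 (k + 1), ((i : ℝ) ^ 2)⁻¹ := by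
          congr 1
          have hIoo : Finset.Ioo 0 (k + 1) = (Finset.range k).image (fun g₀ => 1 + g₀) := by
            ext i
            simp only [Finset.mem_Ioo, Finset.mem_image, Finset.mem_range]
            constructor
            · intro h; exact ⟨i - 1, by omega, by omega⟩
            · rintro ⟨g, hg, rfl⟩; omega
          rw [hIoo, Finset.sum_image (fun a _ b _ h => by omega)]
      _ ≤ (k : ℝ) ^ 2 * 2 := by
          refine mul_le_mul_of_nonneg_left ?_ (by positivity)
          have h := sum_Ioo_inv_sq_le (α := ℝ) 0 (k + 1)
          norm_num at h
          exact h
      _ = 2 * (k : ℝ) ^ 2 := by ring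
  exact_mod_cast hreal

/-- **Counting lemma.**  `T(d, k) ≤ 2 ^ d · k ^ 2`. -/
theorem card_Tset_le (d k : ℕ) : (Tset d k).card ≤ 2 ^ d * k ^ 2 := by
  induction d generalizing k with
  | zero => simpa using card_Tset_zero_le_sq k
  | succ d ih =>
      calc (Tset (d + 1) k).card ≤ ∑ g₀ ∈ Finset.range k, (Tset d (k / (1 + g₀))).card := card_Tset_succ_le d k
        _ ≤ ∑ g₀ ∈ Finset.range k, 2 ^ d * (k / (1 + g₀)) ^ 2 := Finset.sum_le_sum fun g₀ _ => ih _
        _ = 2 ^ d * ∑ g₀ ∈ Finset.range k, (k / (1 + g₀)) ^ 2 := by rw [Finset.mul_sum]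
        _ ≤ 2 ^ d * (2 * k ^ 2) := Nat.mul_le_mul_left _ (sum_div_sq_le k)
        _ = 2 ^ (d + 1) * k ^ 2 := by ring

/-- If `∏ s, (1 + g s) ≤ k` and every entry is positive then `2 ^ d ≤ k`. -/
theorem two_pow_le_of_mem_Tset {d k : ℕ} {g : Fin d → ℕ} (hg : g ∈ Tset d k) (hpos : ∀ s, 1 ≤ g s) :
    2 ^ d ≤ k := by
  have h := (mem_Tset g).mp hg
  calc 2 ^ d = ∏ _s : Fin d, 2 := by simp
    _ ≤ ∏ s, (1 + g s) := Finset.prod_le_prod' fun s _ => by have := hpos s; omega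
    _ ≤ k := h

end Generic

/-- **Registered sub-goal (file `GenericCount`).**  `|Tset d k| ≤ 2^d k²`. -/
theorem generic_card_Tset_le (d k : ℕ) : (Generic.Tset d k).card ≤ 2 ^ d * k ^ 2 :=
  Generic.card_Tset_le d k

end Summit.ValiantsHypothesis.ValiantsHypothesis.Theorems.NewtonUnitEquationsDissociatedUniform
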